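import Literature.AlgebraicGeometry.HodgeTheory.CorrespondenceActionHodgeClassesOfGysin
import Literature.AlgebraicGeometry.HodgeTheory.HodgeTypePullback
import Literature.AlgebraicGeometry.Motives.VarietiesGeometricallyIntegralProofs
import Literature.AlgebraicGeometry.Resolution.PullbackResidueFields
import HarnessLib

/-!
# The action of a prime correspondence through a resolution: `[V]^* = (τ ≫ pr_W)_* ∘ (τ ≫ pr_X)^*`, its Hodge type without cup products, and Voisin II Prop. 10.26 without the hypotheses "pull-backs / cup products preserve Hodge types"

Family `hodge`, layer `Literature/AlgebraicGeometry/HodgeTheory`. Companion to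
`CorrespondenceActionHodgeClassesOfGysin`, whose construction
`GysinFormalism.hodgeClassCorrespondenceAction` of the two degree-`4` Hodge-class properties of the
action of correspondences consumed by Voisin II, Prop. 10.26 (Bloch–Srinivas) takes, besides the
named facts, two Hodge-theoretic HYPOTHESES on the given data: `hpull` ("`f^*` preserves Hodge
types", `PreservesHodgeType`) and `hcupH` ("the cup product respects the Hodge bigrading",
`CupPreservesHodgeType`). Here both are REMOVED:

* `hpull` is a theorem of the tree for morphisms `f : Y ⟶ X` with `dim Y ≤ dim X`
  (`HodgeTheory/HodgeTypePullback`, `IsOfHodgeType.map_of_le` / `preservesHodgeType_of_le`, from a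
  Hodge model of `Y` alone), and every pull-back in the printed proof goes DOWN in dimension once
  the action of a prime correspondence is computed through a resolution (next item): along
  `j̃ : X̃' → X` (`dim X̃' ≤ 3 ≤ …`, in fact `dim X̃' = dim closure {x'} ≤ dim X`) and along
  `Ṽ → X` (`dim Ṽ = dim X`).
* `hcupH` entered only through the Hodge type of `[Z̃']^*α = pr_{T̃*}(pr_X^*α ∪ cl Z̃')`
  (`IsHodgeCompatible.isOfHodgeType_corrActGen`). For a PRIME cycle `V = closure {z} ⊆ W × X` of
  dimension `d` and a resolution `τ : Ṽ → W × X` of `V` (`Ṽ` smooth projective of dimension `d`,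
  `τ` birational onto `V`; projective Hironaka, Kollár Thm. 3.27, the tree's named fact
  `Resolution.Hironaka1964_projective`), one has `cl(V) = τ_*(1_Ṽ)` (Voisin I §11.1.4: "define the
  class `[Z] ∈ H^{2r}(X, ℤ)` as `τ_*(1_{Z''})`", Voisin II proof of Lemma 9.18:
  "`[Z_i] = PD(j_{i*}([Z̃_i]_fund))`" — here DERIVED from the fields `cl_map` (Prop. 9.21 (ii)),
  `cl_primeCycle` (`cl` of a smooth subvariety) and `gysin_id` of `GysinFormalism`, and the
  push-forward of the fundamental cycle `τ_*[Ṽ] = [V]`, Fulton §1.4, `deg(Ṽ/V) = 1`), whence by the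
  projection formula (Fulton App. B (6)) and functoriality
  `[V]^*(c) = pr_{W*}(pr_X^* c ∪ τ_* 1) = pr_{W*} τ_*(τ^* pr_X^* c) = (τ ≫ pr_W)_*((τ ≫ pr_X)^* c)`
  (`GysinFormalism.corrActGen_primeCycle_eq`): a Gysin image of a pull-back, whose Hodge type is
  given by the bidegree of Gysin morphisms (`IsHodgeCompatible.isOfHodgeType_gysin`, Voisin I
  §7.3.2) and of pull-backs — no cup product.

A by-product: the two cycle-class fields of `IsHodgeCompatible` (rationality of `cl`, Prop. 11.20) are
not needed either — only the Gysin half `GysinFormalism.IsGysinHodgeCompatible` (defined here;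
`IsHodgeCompatible.isGysinHodgeCompatible`).

Result: the construction `GysinFormalism.hodgeClassCorrespondenceActionOfResolutions` of
`HodgeClassCorrespondenceAction n X` from `G` with `hG : G.IsGysinHodgeCompatible`, the named facts `Hironaka1964_projective`,
`nonempty_hodgeModel`, `lefschetzOneOne_rational`, `hodgeClasses_algebraic_of_dim_le_three`, and the
single remaining compatibility `hcupA` (Prop. 9.20 on `X ⊗ Y` in degrees `(4, 2 dim Y)`, used in
property (ii): "the compatibility of the cycle class map with correspondences"). Consumer:
`Barriers/HodgeConjecture/DecompositionOfTheDiagonalDegreeFourOfGysin`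
(`…_of_gysin_of_resolutions`).

## References

* [VoisinHodgeII2003] C. Voisin, Hodge Theory and Complex Algebraic Geometry II, proof of
  Prop. 10.26 (p. 306); proof of Thm. 10.17 (10.7)–(10.9); proof of Lemma 9.18; Prop. 9.21.
* [VoisinHodgeI2002] C. Voisin, Hodge Theory and Complex Algebraic Geometry I, §7.3.2, §11.1.4.
* [FultonYoungTableaux1997] W. Fulton, Young Tableaux, App. B §B.1 (5)–(7).
* [Fulton1998] W. Fulton, Intersection Theory, §1.4.
* [Kollar2007] J. Kollár, Lectures on Resolution of Singularities, Thm. 3.27.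
-/

noncomputable section

open CategoryTheory AlgebraicGeometry MonoidalCategory CartesianMonoidalCategory
open Literature.AlgebraicTopology.SingularHomology

namespace Literature.AlgebraicGeometry.HodgeTheory

section HodgeTheory

variable {n : ℕ} {X : Motives.SchemeOver ℂ}

/-! ### Birational morphisms: the generic point and its residue field -/

/-- A birational morphism between irreducible schemes maps the generic point to the generic point
(it is dominant: its image contains a dense open). The two steps exist in the tree as
`Resolution.IsBirational.isDominant` (`Resolution/AlterationsResolution`) and
`Motives.RatFn.genericPoint_eq_of_isDominant` (`Motives/CartierDivisor`); they are re-proved here in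
eight lines to keep the alterations / Cartier-divisor clusters out of this file's import closure.
[cite: StacksProject, Tag 01RN] -/
theorem base_genericPoint_of_isBirational {X' X₀ : Scheme} [IrreducibleSpace X'] [IrreducibleSpace X₀]
    {π : X' ⟶ X₀} (hπ : Resolution.IsBirational π) : π.base (genericPoint X') = genericPoint X₀ := by
  haveI : IsDominant π := by
    obtain ⟨U, hU, -, hiso⟩ := hπ
    haveI := hiso
    haveI : IsDominant U.ι := ⟨by rw [DenseRange, Scheme.Opens.range_ι]; exact hU⟩
    haveI : IsDominant ((π ⁻¹ᵁ U).ι ≫ π) := by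
      rw [← morphismRestrict_ι]
      infer_instance
    exact IsDominant.of_comp (π ⁻¹ᵁ U).ι π
  apply IsGenericPoint.eq _ (genericPoint_spec X₀)
  have h := (genericPoint_spec X').image π.continuous
  rwa [Set.image_univ, π.denseRange.closure_range] at h

/-- A morphism surjective on the stalk AT `x` is surjective on the residue field at `x` (residue
fields are quotients of the stalks, compatibly) — the pointwise form of the tree's
`Resolution.Scheme.Hom.residueFieldMap_surjective` (which assumes `SurjectiveOnStalks f`), needed
at the generic point of a birational morphism. [folklore] -/
theorem residueFieldMap_surjective_of_stalkMap_surjective {X' X₀ : Scheme} (f : X' ⟶ X₀) (x : X')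
    (h : Function.Surjective (f.stalkMap x)) : Function.Surjective (f.residueFieldMap x) := by
  intro a
  obtain ⟨a, rfl⟩ := X'.residue_surjective x a
  obtain ⟨b, rfl⟩ := h a
  refine ⟨X₀.residue (f.base x) b, ?_⟩
  change (X₀.residue (f.base x) ≫ f.residueFieldMap x) b = (f.stalkMap x ≫ X'.residue x) b
  rw [Scheme.residue_residueFieldMap]

/-- A birational morphism from an integral scheme induces an isomorphism of stalks at the generic
point (the map of function fields; the tree's `Resolution.IsBirational.isIso_stalkMap_genericPoint` of
`Resolution/FiniteBirationalNormal`, re-proved in five lines for the same import reason), hence a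
surjection of residue fields there. [cite: StacksProject, Tag 01RN] -/
theorem residueFieldMap_genericPoint_surjective_of_isBirational {X' X₀ : Scheme} [IsIntegral X']
    {π : X' ⟶ X₀} (hπ : Resolution.IsBirational π) :
    Function.Surjective (π.residueFieldMap (genericPoint X')) := by
  refine residueFieldMap_surjective_of_stalkMap_surjective π _ ?_
  obtain ⟨U, -, hU', hiso⟩ := hπ
  haveI := hiso
  have hη : genericPoint X' ∈ π ⁻¹ᵁ U :=
    ((genericPoint_spec X').mem_open_set_iff (π ⁻¹ᵁ U).isOpen).mpr (by simpa using hU'.nonempty)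
  haveI : IsIso (π.stalkMap (genericPoint X')) :=
    ((MorphismProperty.isomorphisms CommRingCat).arrow_mk_iso_iff
      (morphismRestrictStalkMap π U ⟨genericPoint X', hη⟩)).mp
        ((MorphismProperty.isomorphisms.iff _).mpr inferInstance)
  exact (ConcreteCategory.bijective_of_isIso (π.stalkMap (genericPoint X'))).2

/-! ### A resolution of the closure of a point pushes its fundamental cycle forward to the prime cycle -/

/-- **Resolving a prime cycle.** For a point `z` of a smooth projective `Y` with
`dim closure {z} = d`, there is a morphism `τ : Ṽ ⟶ Y` from a smooth projective variety `Ṽ` of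
dimension `d` — a projective resolution of `closure {z}` with its reduced structure
(`Resolution.Hironaka1964_projective`, Kollár Thm. 3.27) followed by the closed immersion — mapping
the generic point of `Ṽ` to `z` with trivial residue field extension; consequently
`dim Ṽ = height` of its generic point `= d` and `τ_*[Ṽ] = [closure {z}]` for Mathlib's weighted
push-forward of cycles (`deg(Ṽ / closure {z}) = 1`, Fulton §1.4). [cite: Kollar2007, Thm. 3.27]
[cite: Fulton1998, §1.4] -/
theorem exists_resolution_primeCycle (hH : Resolution.Hironaka1964_projective.{0}) {N : ℕ}
    {Y : Motives.SchemeOver ℂ} (hY : Motives.IsSmoothProjective N Y) (z : Y.left) {d : ℕ}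
    (hzd : Order.height z = d) :
    ∃ (V : Motives.SchemeOver ℂ) (τ : V ⟶ Y) (η : V.left), Motives.IsSmoothProjective d V ∧
      IsGenericPoint η Set.univ ∧ Order.height η = d ∧
      ∀ [QuasiCompact τ.left], AlgebraicCycle.map τ.left Order.height Order.height
        (Motives.primeCycle η) = Motives.primeCycle z := by
  set X₀ := Motives.ClosedSubvariety.ofPoint Y.left z with hX₀
  obtain ⟨d', V, π, hV, hπ, hdim⟩ := exists_resolution_ofPoint hH hY z
  obtain rfl : d' = d := by
    rw [hzd] at hdim
    exact_mod_cast hdim.symm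
  haveI : IsIntegral X₀.toSchemeOver.left := inferInstanceAs (IsIntegral X₀.carrier)
  haveI : IsIntegral V.left := Motives.IsSmoothProjective.isIntegral_holds hV
  set τ : V ⟶ Y := π ≫ X₀.ιOver with hτ
  -- `τ` maps the generic point to `z` …
  have hgen : τ.left.base (genericPoint V.left) = z := by
    rw [hτ, Over.comp_left, Scheme.Hom.comp_base, TopCat.comp_app,
      base_genericPoint_of_isBirational hπ]
    exact Motives.ClosedSubvariety.genericPoint_ofPoint z
  -- … with trivial residue field extension
  have hsurj : Function.Surjective (τ.left.residueFieldMap (genericPoint V.left)) := by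
    rw [hτ, Over.comp_left, Scheme.residueFieldMap_comp]
    have h1 := residueFieldMap_genericPoint_surjective_of_isBirational hπ
    have h2 : Function.Surjective
        (X₀.ιOver.left.residueFieldMap (π.left.base (genericPoint V.left))) :=
      Resolution.Scheme.Hom.residueFieldMap_surjective X₀.ι _
    exact h1.comp h2
  -- `Y` and `V` are locally of finite type over `ℂ`
  haveI : LocallyOfFiniteType Y.hom := locallyOfFiniteType_of_isSmoothProjective hY
  haveI : LocallyOfFiniteType (τ.left ≫ Y.hom) := by
    rw [Over.w τ]
    exact locallyOfFiniteType_of_isSmoothProjective hV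
  refine ⟨V, τ, genericPoint V.left, hV, genericPoint_spec V.left, ?_, ?_⟩
  · rw [Motives.height_eq_height_of_residueFieldMap_surjective τ.left Y.hom _ hsurj, hgen, hzd]
  · intro _
    rw [Motives.algebraicCycleMap_primeCycle_of_residueFieldMap_surjective τ.left Y.hom _ hsurj, hgen]

/-! ### `cl[V] = τ_* 1` and `[V]^* = (τ ≫ pr_W)_* ∘ (τ ≫ pr_X)^*` -/

variable {m : ℕ} {W : Motives.SchemeOver ℂ}

/-- **The class of a prime cycle is the Gysin image of `1` along a resolution**: if `τ : Ṽ ⟶ Y`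
(`Ṽ` smooth projective of dimension `d`) pushes the fundamental cycle of `Ṽ` forward to the prime
cycle `[closure {z}]`, then `cl[closure {z}] = τ_*(1_Ṽ)` — from `cl ∘ τ_* = τ_* ∘ cl`
(Prop. 9.21 (ii)), `cl[Ṽ] = (𝟙)_* 1` on `Ṽ` and `(𝟙)_* = 𝟙`. (Voisin I §11.1.4: "define the class
`[Z]` … as `τ_*(1_{Z''})`".) [cite: VoisinHodgeI2002, §11.1.4] [cite: VoisinHodgeII2003, Prop. 9.21 (ii) and proof of Lemma 9.18] -/
theorem GysinFormalism.cl_primeCycle_eq_gysin_one (G : GysinFormalism) {N d e : ℕ}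
    {Y V : Motives.SchemeOver ℂ} (hY : Motives.IsSmoothProjective N Y)
    (hV : Motives.IsSmoothProjective d V) (τ : V ⟶ Y) [QuasiCompact τ.left] (hde : d + e = N)
    (z : Y.left) (hz : Motives.primeCycle z ∈ Motives.cyclesOfDim Y.left d)
    (η : V.left) (hηg : IsGenericPoint η Set.univ) (hη : Motives.primeCycle η ∈ Motives.cyclesOfDim V.left d)
    (hτ : Motives.cyclesOfDimMap d τ.left ⟨Motives.primeCycle η, hη⟩ = ⟨Motives.primeCycle z, hz⟩) :
    G.cl hY hde ⟨Motives.primeCycle z, hz⟩ =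
      G.gysin hV hY τ (show 0 + 2 * N = 2 * e + 2 * d by omega)
        (singularCohomology.one ℂ (Motives.ComplexPoints V)) := by
  haveI : IsClosedImmersion (𝟙 V : V ⟶ V).left := (inferInstance : IsClosedImmersion (𝟙 V.left))
  have hgen : IsGenericPoint η (Set.range (𝟙 V : V ⟶ V).left.base) := by
    have hr : Set.range (𝟙 V : V ⟶ V).left.base = Set.univ := Set.range_eq_univ.mpr fun x ↦ ⟨x, rfl⟩
    rw [hr]
    exact hηg
  rw [← hτ, G.cl_map hV hY τ (Nat.add_zero d) hde, G.cl_primeCycle hV hV (𝟙 V) (Nat.add_zero d) η hgen hη]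
  exact congrArg (G.gysin hV hY τ _) (LinearMap.congr_fun (G.gysin_id hV 0) _)

/-- **The action of a prime correspondence through a resolution** (cup-free form of (10.7) for
`Z = [V]`, `V = closure {z} ⊆ W × X` of dimension `d`, codimension `e`): with `τ : Ṽ ⟶ W ⊗ X` as
above, `[V]^*(c) = pr_{W*}(pr_X^* c ∪ τ_* 1) = pr_{W*} τ_*(τ^* pr_X^* c ∪ 1) = (τ ≫ pr_W)_*((τ ≫ pr_X)^* c)`
— projection formula and functoriality of `f_*`, `f^*`.
[cite: FultonYoungTableaux1997, Appendix B §B.1 (5) and (6)] [cite: VoisinHodgeII2003, proof of Thm. 10.17 (10.7)] -/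
theorem GysinFormalism.corrActGen_primeCycle_eq (G : GysinFormalism)
    (hW : Motives.IsSmoothProjective m W) (hX : Motives.IsSmoothProjective n X) {d e : ℕ}
    (hde : d + e = m + n) {a b : ℕ} (hab : a + 2 * e = b + 2 * n) (z : ↥(W ⊗ X).left)
    (hz : Motives.primeCycle z ∈ Motives.cyclesOfDim (W ⊗ X).left d)
    {V : Motives.SchemeOver ℂ} (hV : Motives.IsSmoothProjective d V) (τ : V ⟶ W ⊗ X)
    [QuasiCompact τ.left] (η : V.left) (hηg : IsGenericPoint η Set.univ)
    (hη : Motives.primeCycle η ∈ Motives.cyclesOfDim V.left d)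
    (hτ : Motives.cyclesOfDimMap d τ.left ⟨Motives.primeCycle η, hη⟩ = ⟨Motives.primeCycle z, hz⟩)
    (c : complexBetti X a) :
    G.corrActGen hW hX hde hab ⟨Motives.primeCycle z, hz⟩ c =
      G.gysin hV hW (τ ≫ fst W X) (show a + 2 * m = b + 2 * d by omega)
        (complexBetti.map (τ ≫ snd W X) a c) := by
  have hWX := Motives.IsSmoothProjective.tensor_holds hW hX
  rw [G.corrActGen_apply, G.cl_primeCycle_eq_gysin_one hWX hV τ hde z hz η hηg hη hτ,
    ← G.gysin_cup hV hWX τ (Nat.add_zero a) (show a + 2 * (m + n) = a + 2 * e + 2 * d by omega)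
      (show 0 + 2 * (m + n) = 2 * e + 2 * d by omega) rfl,
    cupProduct_one, ← LinearMap.comp_apply (f := G.gysin hWX hW (fst W X) _)
      (g := G.gysin hV hWX τ _), ← G.gysin_comp hV hWX hW τ (fst W X), complexBetti.map_comp,
    CategoryTheory.comp_apply]

/-! ### Hodge compatibility of the Gysin morphisms alone -/

/-- **Hodge compatibility of the Gysin morphisms** (predicate on `G : GysinFormalism`): fields (1) and
(2) of `GysinFormalism.IsHodgeCompatible` — `f_*` preserves rational classes and is a morphism of
Hodge structures of bidegree `(dim X - dim Y, dim X - dim Y)` (Voisin I §7.3.2 with Lemma 7.30). The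
two fields on the cycle class (rationality, Prop. 11.20) are NOT needed for Prop. 10.26 once
`cl[V] = τ_* 1` is available (this file), so its consumers take this weaker predicate.
[cite: VoisinHodgeI2002, §7.3.2] [cite: FultonYoungTableaux1997, Appendix B §B.1 (5)] -/
structure GysinFormalism.IsGysinHodgeCompatible (G : GysinFormalism) : Prop where
  /-- `f_*` preserves rational classes. [cite: VoisinHodgeI2002, §7.3.2] -/
  isRationalClass_gysin {m n : ℕ} {Y X : Motives.SchemeOver ℂ} (hY : Motives.IsSmoothProjective m Y)
    (hX : Motives.IsSmoothProjective n X) (f : Y ⟶ X) {a b : ℕ} (hab : a + 2 * n = b + 2 * m)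
    {y : complexBetti Y a} : IsRationalClass y → IsRationalClass (G.gysin hY hX f hab y)
  /-- `f_*` has bidegree `(r, r)`, `r = dim X - dim Y`, on Hodge types. [cite: VoisinHodgeI2002, §7.3.2 (with Lemma 7.30)] -/
  isOfHodgeType_gysin {m n : ℕ} {Y X : Motives.SchemeOver ℂ} (hY : Motives.IsSmoothProjective m Y)
    (hX : Motives.IsSmoothProjective n X) (f : Y ⟶ X) {a b : ℕ} (hab : a + 2 * n = b + 2 * m)
    {p q p' q' : ℕ} (hp : p' + m = p + n) (hq : q' + m = q + n) {y : complexBetti Y a} :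
    IsOfHodgeType m Y a p q y → IsOfHodgeType n X b p' q' (G.gysin hY hX f hab y)

/-- A Hodge-compatible formalism is Gysin-Hodge-compatible. [cite: VoisinHodgeI2002, §7.3.2] -/
theorem GysinFormalism.IsHodgeCompatible.isGysinHodgeCompatible {G : GysinFormalism}
    (hG : G.IsHodgeCompatible) : G.IsGysinHodgeCompatible :=
  ⟨hG.isRationalClass_gysin, hG.isOfHodgeType_gysin⟩

/-! ### Rationality and Hodge type of `[V]^*α` without the cycle-class fields and without cup products -/

namespace GysinFormalism.IsGysinHodgeCompatible

variable {G : GysinFormalism} (hG : G.IsGysinHodgeCompatible)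
include hG

/-- **`[V]^*` preserves rational classes**, for a prime cycle `V` through a resolution:
`[V]^*(c) = (τ ≫ pr_W)_*((τ ≫ pr_X)^* c)`, pull-backs preserve rational cocycles and `f_*` preserves
rational classes. (No rationality of `cl` is used.) [cite: VoisinHodgeII2003, proof of Prop. 10.26]
[cite: VoisinHodgeI2002, §7.3.2] -/
theorem isRationalClass_corrActGen_primeCycle
    (hW : Motives.IsSmoothProjective m W) (hX : Motives.IsSmoothProjective n X) {d e : ℕ}
    (hde : d + e = m + n) {a b : ℕ} (hab : a + 2 * e = b + 2 * n) (z : ↥(W ⊗ X).left)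
    (hz : Motives.primeCycle z ∈ Motives.cyclesOfDim (W ⊗ X).left d)
    {V : Motives.SchemeOver ℂ} (hV : Motives.IsSmoothProjective d V) (τ : V ⟶ W ⊗ X)
    [QuasiCompact τ.left] (η : V.left) (hηg : IsGenericPoint η Set.univ)
    (hη : Motives.primeCycle η ∈ Motives.cyclesOfDim V.left d)
    (hτ : Motives.cyclesOfDimMap d τ.left ⟨Motives.primeCycle η, hη⟩ = ⟨Motives.primeCycle z, hz⟩)
    {c : complexBetti X a} (hc : IsRationalClass c) :
    IsRationalClass (G.corrActGen hW hX hde hab ⟨Motives.primeCycle z, hz⟩ c) := by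
  rw [G.corrActGen_primeCycle_eq hW hX hde hab z hz hV τ η hηg hη hτ]
  exact hG.isRationalClass_gysin hV hW (τ ≫ fst W X) _ (hc.map _)

/-- **`[V]^*` is of bidegree `(e - dim X, e - dim X)` on Hodge types, for a prime cycle `V` of
codimension `e` in `W × X` of dimension `d ≤ dim X`, WITHOUT the hypotheses `hmap`, `hcup` of
`isOfHodgeType_corrActGen`**: `[V]^*(c) = (τ ≫ pr_W)_*((τ ≫ pr_X)^* c)` through a resolution
`τ : Ṽ → W × X`; `(τ ≫ pr_X)^*` preserves Hodge types (`IsOfHodgeType.map_of_le`, `dim Ṽ = d ≤ dim X`,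
given a Hodge model `B` of `Ṽ`), and `(τ ≫ pr_W)_*` has bidegree `(dim W - d, dim W - d)` (Hodge
compatibility of `G`). In Prop. 10.26: `[Z̃']^*α` is of type `(1,1)` on `T̃`.
[cite: VoisinHodgeI2002, §7.3.2] [cite: VoisinHodgeII2003, proof of Prop. 10.26] -/
theorem isOfHodgeType_corrActGen_primeCycle
    (hW : Motives.IsSmoothProjective m W) (hX : Motives.IsSmoothProjective n X) {d e : ℕ}
    (hde : d + e = m + n) {a b : ℕ} (hab : a + 2 * e = b + 2 * n) (z : ↥(W ⊗ X).left)
    (hz : Motives.primeCycle z ∈ Motives.cyclesOfDim (W ⊗ X).left d)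
    {V : Motives.SchemeOver ℂ} (hV : Motives.IsSmoothProjective d V) (τ : V ⟶ W ⊗ X)
    [QuasiCompact τ.left] (η : V.left) (hηg : IsGenericPoint η Set.univ)
    (hη : Motives.primeCycle η ∈ Motives.cyclesOfDim V.left d)
    (hτ : Motives.cyclesOfDimMap d τ.left ⟨Motives.primeCycle η, hη⟩ = ⟨Motives.primeCycle z, hz⟩)
    (B : HodgeModel d V) (hdn : d ≤ n) {p q p' q' : ℕ} (hp : p' + n = p + e) (hq : q' + n = q + e)
    {c : complexBetti X a} (hc : IsOfHodgeType n X a p q c) :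
    IsOfHodgeType m W b p' q' (G.corrActGen hW hX hde hab ⟨Motives.primeCycle z, hz⟩ c) := by
  rw [G.corrActGen_primeCycle_eq hW hX hde hab z hz hV τ η hηg hη hτ]
  exact hG.isOfHodgeType_gysin hV hW (τ ≫ fst W X) _ (p := p) (q := q) (by omega) (by omega)
    (hc.map_of_le hV hX B (τ ≫ snd W X) hdn)

end GysinFormalism.IsGysinHodgeCompatible

/-! ### Property (i) without `hpull`, `hcupH` -/

/-- **Property (i) for a prime cycle over a point of codimension `1`, cup-free** (cf.
`GysinFormalism.corrAct_primeCycle_mem_algebraicClasses_of_coheight_eq_one`): `V = closure {z} ⊆ X ⊗ X`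
`n`-dimensional with `pr₁(z) = t` of codimension `1`, `α ∈ H⁴(X(ℂ); ℂ)` rational of type `(2,2)`;
`k : T̃ → closure {t} ⊆ X` a projective resolution (`dim T̃ + 1 = n`), `[Ṽ]` the lift of `[V]` along
`k ▷ X`: `[V]^*α = k_*([Ṽ]^*α)` ((10.8)); `[Ṽ]^*α ∈ H²(T̃(ℂ); ℂ)` is rational (Hodge compatibility of
`G`) and of type `(1,1)` — computed through a resolution of `Ṽ ⊆ T̃ × X` (`dim Ṽ = n = dim X`,
`isOfHodgeType_corrActGen_primeCycle`, Hodge model of the resolution from `hM`) — hence a divisor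
class (Lefschetz `(1,1)`, `h11`), and `k_*` maps `N¹ H²(T̃)` into `N² H⁴(X)`.
[cite: VoisinHodgeII2003, proof of Prop. 10.26 (p. 306)] [cite: VoisinHodgeI2002, §7.3.2 and Thm. 11.30]
[cite: Kollar2007, Thm. 3.27] -/
theorem GysinFormalism.corrAct_primeCycle_mem_algebraicClasses_of_coheight_eq_one' (G : GysinFormalism)
    (hG : G.IsGysinHodgeCompatible) (hH : Resolution.Hironaka1964_projective.{0})
    (hX : Motives.IsSmoothProjective n X)
    (hM : ∀ (m : ℕ) (Y : Motives.SchemeOver ℂ), nonempty_hodgeModel m Y)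
    (h11 : lefschetzOneOne_rational) (z : ↥(X ⊗ X).left)
    (hz : Motives.primeCycle z ∈ Motives.cyclesOfDim (X ⊗ X).left n) (hzn : Order.height z = n)
    (h1 : Order.coheight ((fst X X).left.base z) = 1)
    (α : complexBetti X (2 * 2)) (hα : IsRationalClass α) (h22 : IsOfHodgeType n X (2 * 2) 2 2 α) :
    G.corrAct hX hX (2 * 2) ⟨Motives.primeCycle z, hz⟩ α ∈ algebraicClasses X 2 := by
  classical
  set t := (fst X X).left.base z with ht
  set T₀ := Motives.ClosedSubvariety.ofPoint X.left t with hT₀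
  obtain ⟨d', T₁, π, hT₁, hπ, hdim⟩ := exists_resolution_ofPoint hH hX t
  -- `dim T₁ + 1 = n`: `height t + coheight t = n`, `coheight t = 1`
  have hd'n : d' + 1 = n := by
    obtain ⟨a, b, ha, hb, hab⟩ := exists_height_eq_coheight_eq hX t
    rw [hdim] at ha
    rw [h1] at hb
    have ha' : d' = a := by exact_mod_cast ha
    have hb' : (1 : ℕ) = b := by exact_mod_cast hb
    omega
  have hXX := Motives.IsSmoothProjective.tensor_holds hX hX
  have hT₁X := Motives.IsSmoothProjective.tensor_holds hT₁ hX
  haveI := noetherianSpace_of_isSmoothProjective hT₁X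
  set kT : T₁ ⟶ X := π ≫ T₀.ιOver with hkT
  -- lift `[closure z]` along `kT ▷ X`
  obtain ⟨z₁, hz₁, hmap⟩ := Motives.primeCycle_lift_whiskerRight_of_isBirational hX hX hT₁ T₀ kT
    π.left rfl hπ z (by rw [Motives.ClosedSubvariety.genericPoint_ofPoint])
  have hz₁n' : Order.height z₁ = n := by rw [hz₁, hzn]
  have hz₁n : Motives.primeCycle z₁ ∈ Motives.cyclesOfDim (T₁ ⊗ X).left n :=
    Motives.primeCycle_mem_cyclesOfDim hz₁n'
  have hpush : Motives.cyclesOfDimMap n (kT ▷ X).left ⟨Motives.primeCycle z₁, hz₁n⟩ =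
      ⟨Motives.primeCycle z, hz⟩ := Subtype.ext hmap
  -- (10.8): `[V]^*α = k_*([Ṽ]^*α)`, `[Ṽ]^* : H⁴(X) → H²(T₁)`
  rw [← hpush, G.corrAct_eq_corrActGen,
    G.corrActGen_cyclesOfDimMap_whiskerRight hX hT₁ hX kT rfl (show n + d' = d' + n by omega) rfl
      (show 2 * 2 + 2 * d' = 2 * 1 + 2 * n by omega) ⟨Motives.primeCycle z₁, hz₁n⟩,
    LinearMap.comp_apply]
  -- a resolution of `Ṽ = closure {z₁} ⊆ T₁ ⊗ X` (`dim Ṽ = n`) and a Hodge model of it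
  obtain ⟨V, τ, η, hV, hηg, hηn, hτ⟩ := exists_resolution_primeCycle hH hT₁X z₁ hz₁n'
  haveI : QuasiCompact τ.left := by
    haveI := isProper_left_of_isSmoothProjective hV hT₁X τ
    infer_instance
  have hη : Motives.primeCycle η ∈ Motives.cyclesOfDim V.left n := Motives.primeCycle_mem_cyclesOfDim hηn
  have hτ' : Motives.cyclesOfDimMap n τ.left ⟨Motives.primeCycle η, hη⟩ = ⟨Motives.primeCycle z₁, hz₁n⟩ :=
    Subtype.ext hτ
  obtain ⟨B⟩ := (hM n V).nonempty hV
  -- `[Ṽ]^*α` is a rational `(1,1)`-class on `T₁`, hence a divisor class; `k_*` maps `N¹ H²` to `N² H⁴`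
  refine G.gysin_mem_algebraicClasses hT₁ hX kT (p := 1) (q := 2) (by omega) (h11 hT₁ _ ?_ ?_)
  · exact hG.isRationalClass_corrActGen_primeCycle hT₁ hX _ _ z₁ hz₁n hV τ η hηg hη hτ' hα
  · exact hG.isOfHodgeType_corrActGen_primeCycle hT₁ hX _ _ z₁ hz₁n hV τ η hηg hη hτ' B le_rfl
      (by omega) (by omega) h22

/-- **Property (i), cup-free** (cf. `GysinFormalism.corrAct_mem_algebraicClasses_of_fst`): a
correspondence `Z ∈ Z_n(X ⊗ X)` supported in `T × X`, `T ≠ X` Zariski-closed, maps every rational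
`(2,2)`-class of `H⁴(X(ℂ); ℂ)` into `algebraicClasses X 2` — additivity over prime cycles; codimension
`≥ 2` of `pr₁(z)` is the support case, codimension `1` the divisorial case above. Hypotheses: Hodge
compatibility of `G`, projective Hironaka, Hodge models, Lefschetz `(1,1)`.
[cite: VoisinHodgeII2003, proof of Prop. 10.26 (p. 306)] -/
theorem GysinFormalism.corrAct_mem_algebraicClasses_of_fst' (G : GysinFormalism)
    (hG : G.IsGysinHodgeCompatible) (hH : Resolution.Hironaka1964_projective.{0})
    (hX : Motives.IsSmoothProjective n X)
    (hM : ∀ (m : ℕ) (Y : Motives.SchemeOver ℂ), nonempty_hodgeModel m Y)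
    (h11 : lefschetzOneOne_rational) {Z : ↥(Motives.cyclesOfDim (X ⊗ X).left n)} {T : Set X.left}
    (hT : IsClosed T) (hTX : T ≠ Set.univ)
    (hZ : ∀ z, (Z : AlgebraicCycle (X ⊗ X).left ℤ) z ≠ 0 → (fst X X).left.base z ∈ T)
    (α : complexBetti X (2 * 2)) (hα : IsRationalClass α) (h22 : IsOfHodgeType n X (2 * 2) 2 2 α) :
    G.corrAct hX hX (2 * 2) Z α ∈ algebraicClasses X 2 := by
  refine G.corrAct_mem_of_primeCycle hX hX (2 * 2) _ Z α fun z hz0 hz ↦ ?_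
  have h1 : (1 : ℕ∞) ≤ Order.coheight ((fst X X).left.base z) :=
    one_le_coheight_of_mem_of_isClosed hX hT hTX (hZ z hz0)
  by_cases h2 : (2 : ℕ∞) ≤ Order.coheight ((fst X X).left.base z)
  · exact G.corrAct_primeCycle_mem_algebraicClasses_of_two_le_coheight hX z hz h2 α
  · have he : Order.coheight ((fst X X).left.base z) = 1 := by
      obtain ⟨a, b, -, hb, -⟩ := exists_height_eq_coheight_eq hX ((fst X X).left.base z)
      rw [hb] at h1 h2 ⊢
      have h1' : 1 ≤ b := by exact_mod_cast h1
      have h2' : ¬ (2 ≤ b) := fun h ↦ h2 (by exact_mod_cast h)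
      exact_mod_cast (show b = 1 by omega)
    exact G.corrAct_primeCycle_mem_algebraicClasses_of_coheight_eq_one' hG hH hX hM h11 z hz
      (Z.2 z hz0) he α hα h22

/-! ### Property (ii) without `hpull` -/

/-- **Property (ii) for a prime cycle, with "pull-backs preserve Hodge types" proved** (cf.
`GysinFormalism.corrAct_primeCycle_mem_algebraicClasses_of_snd`): `V = closure {z} ⊆ X ⊗ X`
`n`-dimensional with `pr₂(z) = x'` of dimension `≤ d ≤ 3`; with `j̃ : X̃' → closure {x'} ⊆ X` a
projective resolution (`dim X̃' = dim closure {x'} ≤ dim X`) and `[Ṽ]` the lift of `[V]` along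
`X ◁ j̃`: `[V]^*α = [Ṽ]^*(j̃^*α)` ((10.9)); `j̃^*α` is rational of type `(2,2)`
(`preservesHodgeType_of_le`, Hodge model of `X̃'` from `hM`) on `X̃'` of dimension `≤ 3`, hence
algebraic (`h3`), and `[Ṽ]^*` preserves algebraic classes granted Prop. 9.20 on `X ⊗ X̃'` (`hcupA`).
[cite: VoisinHodgeII2003, proof of Prop. 10.26 (p. 306)] [cite: Kollar2007, Thm. 3.27] -/
theorem GysinFormalism.corrAct_primeCycle_mem_algebraicClasses_of_snd' (G : GysinFormalism)
    (hH : Resolution.Hironaka1964_projective.{0}) (hX : Motives.IsSmoothProjective n X)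
    (hM : ∀ (m : ℕ) (Y : Motives.SchemeOver ℂ), nonempty_hodgeModel m Y)
    (hcupA : ∀ ⦃m : ℕ⦄ ⦃Y : Motives.SchemeOver ℂ⦄, Motives.IsSmoothProjective m Y →
      ∀ ⦃x : complexBetti (X ⊗ Y) (2 * 2)⦄ ⦃y : complexBetti (X ⊗ Y) (2 * m)⦄,
        x ∈ algebraicClasses (X ⊗ Y) 2 → y ∈ algebraicClasses (X ⊗ Y) m →
          cupProduct (two_mul_add_two_mul 2 m) x y ∈ algebraicClasses (X ⊗ Y) (2 + m))
    (h3 : hodgeClasses_algebraic_of_dim_le_three) (z : ↥(X ⊗ X).left)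
    (hz : Motives.primeCycle z ∈ Motives.cyclesOfDim (X ⊗ X).left n) (hzn : Order.height z = n)
    {d : ℕ} (hd : Order.height ((snd X X).left.base z) ≤ d) (hd3 : d ≤ 3)
    (α : complexBetti X (2 * 2)) (hα : IsRationalClass α) (h22 : IsOfHodgeType n X (2 * 2) 2 2 α) :
    G.corrAct hX hX (2 * 2) ⟨Motives.primeCycle z, hz⟩ α ∈ algebraicClasses X 2 := by
  classical
  set x' := (snd X X).left.base z with hx'
  set X₀ := Motives.ClosedSubvariety.ofPoint X.left x' with hX₀
  obtain ⟨d', X₁, π, hX₁, hπ, hdim⟩ := exists_resolution_ofPoint hH hX x'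
  -- `d' = dim closure {x'} ≤ d ≤ 3` and `d' ≤ n`
  have hd'3 : d' ≤ 3 := by
    have h := hd.trans (show (d : ℕ∞) ≤ 3 by exact_mod_cast hd3)
    rw [hdim] at h
    exact_mod_cast h
  have hd'n : d' ≤ n := by
    obtain ⟨a, b, ha, -, hab⟩ := exists_height_eq_coheight_eq hX x'
    rw [hdim] at ha
    have ha' : d' = a := by exact_mod_cast ha
    omega
  have hXX := Motives.IsSmoothProjective.tensor_holds hX hX
  have hXX₁ := Motives.IsSmoothProjective.tensor_holds hX hX₁
  haveI := noetherianSpace_of_isSmoothProjective hXX₁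
  set j : X₁ ⟶ X := π ≫ X₀.ιOver with hj
  -- lift `[closure z]` along `X ◁ j`
  obtain ⟨z₁, hz₁, hmap⟩ := Motives.primeCycle_lift_of_isBirational_holds hX hX hX₁ X₀ j π.left rfl
    hπ z (by rw [Motives.ClosedSubvariety.genericPoint_ofPoint])
  have hz₁n : Motives.primeCycle z₁ ∈ Motives.cyclesOfDim (X ⊗ X₁).left n :=
    Motives.primeCycle_mem_cyclesOfDim (by rw [hz₁, hzn])
  have hpush : Motives.cyclesOfDimMap n (X ◁ j).left ⟨Motives.primeCycle z₁, hz₁n⟩ =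
      ⟨Motives.primeCycle z, hz⟩ := Subtype.ext hmap
  -- (10.9): `[V]^*α = [Ṽ]^*(j^*α)`
  rw [← hpush, G.corrAct_eq_corrActGen,
    G.corrActGen_cyclesOfDimMap_whiskerLeft hX hX hX₁ j rfl (show n + d' = n + d' from rfl) rfl
      (show 2 * 2 + 2 * d' = 2 * 2 + 2 * d' from rfl) ⟨Motives.primeCycle z₁, hz₁n⟩,
    LinearMap.comp_apply]
  -- `j^*α` is a rational `(2,2)`-class on `X₁` (pull-backs preserve Hodge types, `dim X₁ ≤ dim X`),
  -- `dim X₁ ≤ 3`, hence algebraic; `[Ṽ]^*` preserves that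
  obtain ⟨B⟩ := (hM d' X₁).nonempty hX₁
  have hjα : (complexBetti.map j (2 * 2)).hom α ∈ algebraicClasses X₁ 2 :=
    h3 hd'3 hX₁ 2 _ (hα.map _) (preservesHodgeType_of_le hX₁ hX B j hd'n h22)
  exact G.corrActGen_mem_algebraicClasses hX hX₁ rfl (p := 2) (q := 2) rfl (hcupA hX₁)
    ⟨Motives.primeCycle z₁, hz₁n⟩ hjα

/-- **Property (ii) with "pull-backs preserve Hodge types" proved** (cf.
`GysinFormalism.corrAct_mem_algebraicClasses_of_snd`): a correspondence `Z ∈ Z_n(X ⊗ X)` supported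
in `X × X'` with every point of `X'` of dimension `≤ d ≤ 3` maps rational `(2,2)`-classes of `H⁴` into
`algebraicClasses X 2`. Hypotheses: projective Hironaka, Hodge models, Prop. 9.20 on products
(`hcupA`), the Hodge conjecture in dimension `≤ 3`. [cite: VoisinHodgeII2003, proof of Prop. 10.26 (p. 306)] -/
theorem GysinFormalism.corrAct_mem_algebraicClasses_of_snd' (G : GysinFormalism)
    (hH : Resolution.Hironaka1964_projective.{0}) (hX : Motives.IsSmoothProjective n X)
    (hM : ∀ (m : ℕ) (Y : Motives.SchemeOver ℂ), nonempty_hodgeModel m Y)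
    (hcupA : ∀ ⦃m : ℕ⦄ ⦃Y : Motives.SchemeOver ℂ⦄, Motives.IsSmoothProjective m Y →
      ∀ ⦃x : complexBetti (X ⊗ Y) (2 * 2)⦄ ⦃y : complexBetti (X ⊗ Y) (2 * m)⦄,
        x ∈ algebraicClasses (X ⊗ Y) 2 → y ∈ algebraicClasses (X ⊗ Y) m →
          cupProduct (two_mul_add_two_mul 2 m) x y ∈ algebraicClasses (X ⊗ Y) (2 + m))
    (h3 : hodgeClasses_algebraic_of_dim_le_three) {Z : ↥(Motives.cyclesOfDim (X ⊗ X).left n)}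
    {W : Set X.left} {d : ℕ} (hd : ∀ w ∈ W, Order.height w ≤ d) (hd3 : d ≤ 3)
    (hZ : ∀ z, (Z : AlgebraicCycle (X ⊗ X).left ℤ) z ≠ 0 → (snd X X).left.base z ∈ W)
    (α : complexBetti X (2 * 2)) (hα : IsRationalClass α) (h22 : IsOfHodgeType n X (2 * 2) 2 2 α) :
    G.corrAct hX hX (2 * 2) Z α ∈ algebraicClasses X 2 :=
  G.corrAct_mem_of_primeCycle hX hX (2 * 2) _ Z α fun z hz0 hz ↦
    G.corrAct_primeCycle_mem_algebraicClasses_of_snd' hH hX hM hcupA h3 z hz (Z.2 z hz0)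
      (hd _ (hZ z hz0)) hd3 α hα h22

/-! ### The construction, from `(G, hG)`, the named facts and `hcupA` only -/

/-- **`HodgeClassCorrespondenceAction n X` from a Gysin/cycle-class formalism whose Gysin morphisms are
Hodge compatible (`IsGysinHodgeCompatible`), the named facts `Hironaka1964_projective`, `nonempty_hodgeModel`, `lefschetzOneOne_rational`,
`hodgeClasses_algebraic_of_dim_le_three`, and Prop. 9.20 on products (`hcupA`)** — the construction
`GysinFormalism.hodgeClassCorrespondenceAction` with its hypotheses `hpull` (pull-backs preserve Hodge
types) and `hcupH` (cup products preserve Hodge types) discharged: the former by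
`HodgeTheory/HodgeTypePullback`, the latter avoided by computing `[V]^*` through resolutions.
[cite: VoisinHodgeII2003, proof of Prop. 10.26 (p. 306), Prop. 9.21, Lemma 9.18 and proof of Thm. 10.17 (10.7)–(10.9)]
[cite: VoisinHodgeI2002, §7.3.2, §11.1.4 and Thm. 11.30] [cite: Kollar2007, Thm. 3.27] -/
def GysinFormalism.hodgeClassCorrespondenceActionOfResolutions (G : GysinFormalism)
    (hG : G.IsGysinHodgeCompatible) (hX : Motives.IsSmoothProjective n X)
    (hH : Resolution.Hironaka1964_projective.{0})
    (hM : ∀ (m : ℕ) (Y : Motives.SchemeOver ℂ), nonempty_hodgeModel m Y)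
    (hcupA : ∀ ⦃m : ℕ⦄ ⦃Y : Motives.SchemeOver ℂ⦄, Motives.IsSmoothProjective m Y →
      ∀ ⦃x : complexBetti (X ⊗ Y) (2 * 2)⦄ ⦃y : complexBetti (X ⊗ Y) (2 * m)⦄,
        x ∈ algebraicClasses (X ⊗ Y) 2 → y ∈ algebraicClasses (X ⊗ Y) m →
          cupProduct (two_mul_add_two_mul 2 m) x y ∈ algebraicClasses (X ⊗ Y) (2 + m))
    (h11 : lefschetzOneOne_rational) (h3 : hodgeClasses_algebraic_of_dim_le_three) :
    HodgeClassCorrespondenceAction n X where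
  toCorrespondenceAction := G.correspondenceAction hX hH hM
  act_mem_algebraicClasses_of_fst hT hTX hZ α hα h22 :=
    G.corrAct_mem_algebraicClasses_of_fst' hG hH hX hM h11 hT hTX hZ α hα h22
  act_mem_algebraicClasses_of_snd _ _ hd hd3 hZ α hα h22 :=
    G.corrAct_mem_algebraicClasses_of_snd' hH hX hM hcupA h3 hd hd3 hZ α hα h22

/-- The action of `GysinFormalism.hodgeClassCorrespondenceActionOfResolutions` is (10.7):
`[Z]^* = G.corrAct hX hX r`. [cite: VoisinHodgeII2003, proof of Thm. 10.17 (10.7)] -/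
theorem GysinFormalism.hodgeClassCorrespondenceActionOfResolutions_act (G : GysinFormalism)
    (hG : G.IsGysinHodgeCompatible) (hX : Motives.IsSmoothProjective n X)
    (hH : Resolution.Hironaka1964_projective.{0})
    (hM : ∀ (m : ℕ) (Y : Motives.SchemeOver ℂ), nonempty_hodgeModel m Y)
    (hcupA : ∀ ⦃m : ℕ⦄ ⦃Y : Motives.SchemeOver ℂ⦄, Motives.IsSmoothProjective m Y →
      ∀ ⦃x : complexBetti (X ⊗ Y) (2 * 2)⦄ ⦃y : complexBetti (X ⊗ Y) (2 * m)⦄,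
        x ∈ algebraicClasses (X ⊗ Y) 2 → y ∈ algebraicClasses (X ⊗ Y) m →
          cupProduct (two_mul_add_two_mul 2 m) x y ∈ algebraicClasses (X ⊗ Y) (2 + m))
    (h11 : lefschetzOneOne_rational) (h3 : hodgeClasses_algebraic_of_dim_le_three) (r : ℕ) :
    (G.hodgeClassCorrespondenceActionOfResolutions hG hX hH hM hcupA h11 h3).act r = G.corrAct hX hX r :=
  rfl

end HodgeTheory

end Literature.AlgebraicGeometry.HodgeTheory

end
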